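import Literature.Analysis.FluidPDE.TorusNSBerselliGaldiCriterionLowest
import Literature.Analysis.FunctionSpaces.TorusWeightedSobolevInequality
import HarnessLib

/-!
# The rate-of-growth bound for Lebesgue norms of the velocity,
# `(1/q) d/dt ‖u‖_q^q ≤ C ν^{−(q+3)/(q−3)} ‖u‖_q^{q(q−1)/(q−3)}` (`q > 3`), on `T³`
# (Robinson–Sadowski 2014, proof of Theorem 8; Bleitner–Protas 2026, eq. (5))

Analysis/FluidPDE proof file (theorems only; no definitions, no named facts).
Search for candidate a priori estimates; no regularity claim.

Robinson–Sadowski 2014 (Rend. Sem. Mat. Univ. Padova 131), proof of Theorem 8 (pp. 175–176,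
`ν = 1`): multiplying the Navier–Stokes equations by `u|u|^{α−2}` (`α > 3`) and integrating over
`T³` (zero-average periodic case, by their Lemma 2) or `ℝ³`,
`(1/α) d/dt ‖u‖_{L^α}^α ≤ c ‖u‖_{L^α}^{α(α−1)/(α−3)}`, i.e. `X = ‖u‖_{L^α}^α` satisfies
`Ẋ ≤ c X^{(α−1)/(α−3)}`. Bleitner–Protas 2026 (arXiv:2607.02739), eq. (5) and Appendix A, restore
the viscosity: on the torus, for `q > 3`,
`(1/q) d/dt ‖u(t)‖_q^q ≤ C ν^{−(q+3)/(q−3)} ‖u(t)‖_q^{q(q−1)/(q−3)}`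
with `C = C(q)`; their computations (Riemannian conjugate gradients, `q = 4, 5, 6, 9`) indicate that
the exponent is sharp. This is row G8 of the cell's EXTREME-GROWTH table and the `(0, m)` row of
Gibbon's chessboard of a priori rate laws.

Formalised here on the unit flat torus `T^d`, `card d = 3`, for classical solutions of the
unforced Navier–Stokes equations with mean-zero velocity slices:

* `Torus.exists_deriv_integral_norm_rpow_le_of_three_lt` — **the rate law with dissipation**:
  for `3 < q` there is `K = K(q, d) ≥ 0` such that for every `ν > 0`, every classical solution on
  `[a, b] × T^d` with mean-zero slices, every `t ∈ [a, b]` and every one-sided derivative `R` of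
  `s ↦ ∫ ‖u(s)‖^q` within `[a, b]` at `t`,
  `R ≤ −(q−3) ν ∫ ‖u‖^{q−2} ∑ₖ‖∂ₖu‖² + K ν^{−(q+3)/(q−3)} (∫ ‖u‖^q)^{(q−1)/(q−3)}`;
* `Torus.exists_deriv_integral_norm_rpow_le_of_three_lt'` — the printed shape (5):
  `R ≤ K ν^{−(q+3)/(q−3)} (∫ ‖u‖^q)^{(q−1)/(q−3)}`;
* `Torus.classicalNS_continuation_of_lqNorm_lifespan` — Theorem 8 (continuation form);
* `Torus.lqNorm_blowup_rate` — Corollary 9 (necessary blow-up rate in `L^q`, `ν`-scaled).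

PROOF, as printed (Bleitner–Protas App. A = Robinson–Sadowski pp. 175–176), every input a tree
theorem: (A.1) the `L^q` balance with the pressure term absorbed,
`R ≤ −qν ∫|u|^{q−2}|∇u|² + (q(q−2)/(4ν)) ∫ π²|u|^{q−2}`, `π = p − ⟨p⟩`
(`Torus.IsClassicalNSSolutionOn.deriv_integral_normSq_rpow_le_of_two_le`, RRS 2016 (11.19), applied
to the solution `(u, p − ⟨p(t)⟩)`); (A.2) Calderón–Zygmund `‖π‖_{(q+2)/2} ≤ C_P ‖u‖²_{q+2}`
(`Torus.exists_pressure_sub_average_Ls_le_normSq`); Hölder `∫π²|u|^{q−2} ≤ ‖π‖²_{(q+2)/2}‖u‖_{q+2}^{q−2}`,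
hence (A.3) `≤ C_P² ‖u‖_{q+2}^{q+2}`; interpolation `‖u‖_{q+2}^{q+2} ≤ ‖u‖_q^{q−1}‖u‖_{3q}^3`; the
weighted Sobolev inequality `‖u‖_{3q}^q ≤ c ∫|u|^{q−2}|∇u|²` (Robinson–Sadowski Lemma 2, tree
`Torus.exists_rpow_integral_norm_rpow_le_weighted`); Young with exponents `q/3`, `q/(q−3)`,
absorbing `3ν∫|u|^{q−2}|∇u|²` into the dissipation. Deviations from print: classical solutions with
mean-zero slices on the unit torus (print: `ℝ³`/periodic, strong solutions); the dissipation
retained with coefficient `(q−3)ν` (print: `ν/2` resp. dropped); constants existential (through the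
tree's Sobolev and Calderón–Zygmund constants), the `ν`-dependence `ν^{−(q+3)/(q−3)}` explicit.
Section 3 adds Theorem 8 in CONTINUATION form (`Torus.classicalNS_continuation_of_lqNorm_lifespan`:
a classical mean-zero solution on `[0, T)` with `T (∫‖u(0)‖^q)^{2/(q−3)} < c ν^{(q+3)/(q−3)}`
continues past `T`; comparison for `Ẋ ≤ K ν^{−(q+3)/(q−3)} X^{(q−1)/(q−3)}` and the tree's Serrin
continuation `Torus.classicalNS_continuation_of_Ls_rpow_integral_le`) and Corollary 9, the
necessary blow-up rate `‖u(t)‖_{L^q} ≥ (c ν^{(q+3)/(q−3)}/(T − t))^{(q−3)/(2q)}` when `∫‖u‖^q` is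
unbounded on `[a, T)` (`Torus.lqNorm_blowup_rate`). The printed local EXISTENCE of solutions in
`L^p` (Theorem 8 proper) is not asserted.

## Mathlib / tree search

Tree (used): `Torus.IsClassicalNSSolutionOn.deriv_integral_normSq_rpow_le_of_two_le`
(`TorusVelocityRealMomentBalance`), `Torus.exists_pressure_sub_average_Ls_le_normSq`
(`TorusNSBerselliGaldiCriterionLowest`), `Torus.exists_rpow_integral_norm_rpow_le_weighted`
(`TorusWeightedSobolevInequality`), `Torus.gradient_sub_const_apply` (`TorusClassicalNSGluing`),
`Torus.isSmoothSpaceTimeOn_const`; Mathlib `integral_mul_le_Lp_mul_Lq_of_nonneg`,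
`Real.young_inequality_of_nonneg`, `Real.rpow_*`. Searched (`lean search`):
`q - 1\) / \(q - 3|Lebesgue.*rate|norm_rpow.*rate|RobinsonSadowski2014` — nothing on the rate
law; the `L⁴`/`L⁶` saturating laws of the Summits side (`VelocityL4/L6SaturatingLaw`, small-data
shape `U̇ ≤ κν⁻⁵‖∇u‖₂²U²`) are different statements.

## References

* J. C. Robinson, W. Sadowski, *A local smoothness criterion for solutions of the 3D Navier–Stokes
  equations*, Rend. Semin. Mat. Univ. Padova 131 (2014) 159–178, Lemma 2, Theorem 8 and its
  proof (held: paper:doi-10-4171-rsmup-131-9, pp. 17–18). [RobinsonSadowski2014]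
* F. Bleitner, B. Protas, *On the sharpness of bounds on the rate of growth of Lebesgue norms of
  the velocity in Navier–Stokes flows*, arXiv:2607.02739 (2026), eq. (5), Appendix A
  (held: paper:arxiv-2607.02739, pp. 3, 87). [BleitnerProtas2026]
* J. C. Robinson, J. L. Rodrigo, W. Sadowski, *The Three-Dimensional Navier–Stokes Equations*,
  CUP 2016, Exercise 11.4 (11.19). [RobinsonRodrigoSadowskiCUP2016]
-/

noncomputable section

open MeasureTheory Finset Set Filter Topology
open scoped InnerProductSpace RealInnerProductSpace ContDiff

namespace Literature.Analysis.FluidPDE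

open Literature.Analysis.FunctionSpaces

variable {d : Type*} [Fintype d] [DecidableEq d]

namespace LebesgueNormRate

/-! ## 1. Helpers -/

/-- Shifting the pressure by a constant gives again a classical solution (same velocity, same
force): `∇(p − c) = ∇p`. [folklore] -/
private theorem pressure_sub_const {S : Set ℝ} {ν : ℝ}
    {f u : ℝ → UnitAddTorus d → EuclideanSpace ℝ d} {p : ℝ → UnitAddTorus d → ℝ}
    (h : Torus.IsClassicalNSSolutionOn S ν f u p) (c : ℝ) :
    Torus.IsClassicalNSSolutionOn S ν f u (fun t x => p t x - c) where
  smooth_velocity := h.smooth_velocity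
  smooth_pressure :=
    h.smooth_pressure.sub (Torus.isSmoothSpaceTimeOn_const (Torus.isSmooth_const c) S)
  momentum t ht x := by
    rw [Torus.gradient_sub_const_apply]
    exact h.momentum t ht x
  divFree := h.divFree

omit [DecidableEq d] in
/-- Hölder on `T^d` with weights `a + b = 1` for continuous non-negative `f, g`:
`∫ f g ≤ (∫ f^{1/a})^a (∫ g^{1/b})^b`. [folklore] -/
private theorem integral_mul_le_rpow_mul_rpow {f g : UnitAddTorus d → ℝ} (hf : Continuous f)
    (hg : Continuous g) (hf0 : ∀ x, 0 ≤ f x) (hg0 : ∀ x, 0 ≤ g x) {a b : ℝ} (ha : 0 < a)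
    (hb : 0 < b) (hab : a + b = 1) :
    ∫ x, f x * g x ≤ (∫ x, f x ^ a⁻¹) ^ a * (∫ x, g x ^ b⁻¹) ^ b := by
  have hpq : (a⁻¹).HolderConjugate b⁻¹ := Real.HolderConjugate.inv_inv ha hb hab
  have h := integral_mul_le_Lp_mul_Lq_of_nonneg (μ := volume) hpq (ae_of_all _ hf0)
    (ae_of_all _ hg0) (hf.memLp_of_hasCompactSupport (HasCompactSupport.of_compactSpace f))
    (hg.memLp_of_hasCompactSupport (HasCompactSupport.of_compactSpace g))
  simpa only [one_div, inv_inv] using h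

/-- Young's inequality with weights: `x^θ y ≤ θ x + (1 − θ) y^{1/(1−θ)}` for `x, y ≥ 0`,
`0 < θ < 1`. [folklore] -/
private theorem rpow_mul_le_young {x y θ : ℝ} (hx : 0 ≤ x) (hy : 0 ≤ y) (hθ0 : 0 < θ)
    (hθ1 : θ < 1) : x ^ θ * y ≤ θ * x + (1 - θ) * y ^ (1 / (1 - θ)) := by
  have hb : 0 < 1 - θ := by linarith
  have hpq : (θ⁻¹).HolderConjugate (1 - θ)⁻¹ := Real.HolderConjugate.inv_inv hθ0 hb (by ring)
  have h := Real.young_inequality_of_nonneg (Real.rpow_nonneg hx θ) hy hpq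
  have e1 : (x ^ θ) ^ θ⁻¹ / θ⁻¹ = θ * x := by
    rw [← Real.rpow_mul hx, mul_inv_cancel₀ hθ0.ne', Real.rpow_one, div_inv_eq_mul, mul_comm]
  have e2 : y ^ (1 - θ)⁻¹ / (1 - θ)⁻¹ = (1 - θ) * y ^ (1 / (1 - θ)) := by
    rw [div_inv_eq_mul, mul_comm, one_div]
  rw [e1, e2] at h
  exact h

end LebesgueNormRate

open LebesgueNormRate

/-! ## 2. The rate law -/

/-- **The rate-of-growth bound for `‖u‖_{L^q}`, `q > 3`, with dissipation** (Robinson–Sadowski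
2014, proof of Theorem 8: "`(1/α) d/dt ‖u‖^α_{L^α} ≤ c‖u‖_{L^α}^{α(α−1)/(α−3)}`"; Bleitner–Protas
2026, (5) with Appendix A: "`(1/q) d/dt ‖u(t)‖_q^q ≤ C ν^{−(q+3)/(q−3)} ‖u(t)‖_q^{q(q−1)/(q−3)}`,
`q > 3`, where the constant `C > 0` depends only on `q`"). On the unit flat torus `T^d`,
`card d = 3`: for every real `q > 3` there is `K ≥ 0` (depending only on `q` and `d`) such that
for every `ν > 0`, every classical solution `(u, p)` of the unforced Navier–Stokes equations on
`[a, b] × T^d` (`a < b`) with mean-zero velocity slices, every `t ∈ [a, b]` and every one-sided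
derivative `R` of `s ↦ ∫ ‖u(s, x)‖^q dx` within `[a, b]` at `t`,
`R ≤ −(q − 3) ν ∫ ‖u(t)‖^{q−2} ∑ₖ ‖∂ₖu(t)‖² + K ν^{−(q+3)/(q−3)} (∫ ‖u(t)‖^q)^{(q−1)/(q−3)}`.
[cite: RobinsonSadowski2014, Theorem 8 (proof, pp. 175–176)]
[cite: BleitnerProtas2026, eq. (5) and Appendix A] -/
theorem Torus.exists_deriv_integral_norm_rpow_le_of_three_lt (hd : Fintype.card d = 3) {q : ℝ}
    (hq : 3 < q) :
    ∃ K : ℝ, 0 ≤ K ∧ ∀ {ν a b : ℝ}, 0 < ν → a < b →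
      ∀ {u : ℝ → UnitAddTorus d → EuclideanSpace ℝ d} {p : ℝ → UnitAddTorus d → ℝ},
        Torus.IsClassicalNSSolutionOn (Icc a b) ν 0 u p →
        (∀ t ∈ Icc a b, Torus.HasZeroMean (u t)) →
        ∀ t ∈ Icc a b, ∀ R : ℝ,
          HasDerivWithinAt (fun s => ∫ x, ‖u s x‖ ^ q) R (Icc a b) t →
          R ≤ -((q - 3) * ν * ∫ x, ‖u t x‖ ^ (q - 2) * ∑ k, ‖Torus.partialDeriv k (u t) x‖ ^ 2) +
            K * ν ^ (-((q + 3) / (q - 3))) * (∫ x, ‖u t x‖ ^ q) ^ ((q - 1) / (q - 3)) := by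
  haveI : Nonempty d := by rw [← Fintype.card_pos_iff, hd]; norm_num
  have hq0 : 0 < q := by linarith
  have hq2 : 2 < q := by linarith
  have hq3 : 0 < q - 3 := by linarith
  have hqne : q ≠ 0 := hq0.ne'
  have hq1ne : q - 1 ≠ 0 := (by linarith : (0 : ℝ) < q - 1).ne'
  have hq2ne : q - 2 ≠ 0 := (by linarith : (0 : ℝ) < q - 2).ne'
  have hq3ne : q - 3 ≠ 0 := hq3.ne'
  have hq2ne' : q + 2 ≠ 0 := (by linarith : (0 : ℝ) < q + 2).ne'
  -- the two analytic constants
  obtain ⟨CP, hCP0, hCP⟩ :=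
    Torus.exists_pressure_sub_average_Ls_le_normSq (d := d) (γ := (q + 2) / 2) (by linarith)
  obtain ⟨c, hc0, hc⟩ := Torus.exists_rpow_integral_norm_rpow_le_weighted (d := d) hd hq2
  -- exponents
  set θ : ℝ := 3 / q with hθ
  have hθ0 : 0 < θ := by rw [hθ]; positivity
  have hθ1 : θ < 1 := by rw [hθ, div_lt_one hq0]; exact hq
  have h1θ : 1 - θ = (q - 3) / q := by rw [hθ]; field_simp
  have h1θ' : 1 / (1 - θ) = q / (q - 3) := by rw [h1θ, one_div, inv_div]
  set coef : ℝ := q * (q - 2) / 4 * CP ^ 2 * c ^ θ with hcoef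
  have hcoef0 : 0 ≤ coef := by
    have : 0 ≤ q * (q - 2) / 4 := by nlinarith
    rw [hcoef]
    exact mul_nonneg (mul_nonneg this (sq_nonneg _)) (Real.rpow_nonneg hc0 _)
  set K : ℝ := (1 - θ) * (coef * q ^ (-θ)) ^ (q / (q - 3)) with hK
  have hK0 : 0 ≤ K := by
    rw [hK]
    exact mul_nonneg (by linarith) (Real.rpow_nonneg (mul_nonneg hcoef0
      (Real.rpow_nonneg hq0.le _)) _)
  refine ⟨K, hK0, fun {ν a b} hν hab {u p} h hmean t ht R hR => ?_⟩
  -- ### Step 0: the balance (A.1) for the solution `(u, p − ⟨p(t)⟩)`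
  have e_fun : (fun s => ∫ x, ‖u s x‖ ^ q) = fun s => ∫ x, (‖u s x‖ ^ 2) ^ (q / 2) := by
    funext s
    refine integral_congr_ae (ae_of_all _ fun x => ?_)
    show ‖u s x‖ ^ q = (‖u s x‖ ^ 2) ^ (q / 2)
    rw [← Real.rpow_natCast, ← Real.rpow_mul (norm_nonneg _)]
    congr 1; push_cast; ring
  rw [e_fun] at hR
  set c₀ : ℝ := ∫ y, p t y with hc₀
  have h' := pressure_sub_const h c₀
  have hbal := h'.deriv_integral_normSq_rpow_le_of_two_le hν hab (α := q) (by linarith) ht hR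
  simp only [Pi.zero_apply, inner_zero_right, mul_zero, integral_zero, add_zero] at hbal
  -- ### notation for the slice
  have hut : Torus.IsSmooth (u t) := h.smooth_velocity.isSmooth_slice ht
  have hpt : Torus.IsSmooth (p t) := h.smooth_pressure.isSmooth_slice ht
  have huc : Continuous (u t) := hut.continuous
  have hwc : Continuous fun x => ‖u t x‖ := huc.norm
  have hπc : Continuous fun x => p t x - c₀ := hpt.continuous.sub continuous_const
  have hgradc : Continuous fun x => ∑ k, ‖Torus.partialDeriv k (u t) x‖ ^ 2 :=
    continuous_finsetSum _ fun k _ => (hut.partialDeriv k).continuous.norm.pow 2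
  have hgrad0 : ∀ x, 0 ≤ ∑ k, ‖Torus.partialDeriv k (u t) x‖ ^ 2 := fun x =>
    Finset.sum_nonneg fun k _ => sq_nonneg _
  set X : ℝ := ∫ x, ‖u t x‖ ^ (q - 2) * ∑ k, ‖Torus.partialDeriv k (u t) x‖ ^ 2 with hX
  set U : ℝ := ∫ x, ‖u t x‖ ^ q with hU
  set A : ℝ := ∫ x, ‖u t x‖ ^ (q + 2) with hA
  set B : ℝ := ∫ x, ‖u t x‖ ^ (3 * q) with hB
  set P : ℝ := ∫ x, (p t x - c₀) ^ 2 * (‖u t x‖ ^ 2) ^ (q / 2 - 1) with hP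
  have hX0 : 0 ≤ X :=
    integral_nonneg fun x => mul_nonneg (Real.rpow_nonneg (norm_nonneg _) _) (hgrad0 x)
  have hU0 : 0 ≤ U := integral_nonneg fun x => Real.rpow_nonneg (norm_nonneg _) _
  have hA0 : 0 ≤ A := integral_nonneg fun x => Real.rpow_nonneg (norm_nonneg _) _
  have hB0 : 0 ≤ B := integral_nonneg fun x => Real.rpow_nonneg (norm_nonneg _) _
  -- pointwise power identities
  have hpw : ∀ (x : UnitAddTorus d) (r : ℝ), (‖u t x‖ ^ 2) ^ r = ‖u t x‖ ^ (2 * r) :=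
    fun x r => by rw [← Real.rpow_natCast, ← Real.rpow_mul (norm_nonneg _)]; push_cast; ring_nf
  have eXw : ∫ x, (‖u t x‖ ^ 2) ^ (q / 2 - 1) * ∑ k, ‖Torus.partialDeriv k (u t) x‖ ^ 2 = X := by
    rw [hX]
    refine integral_congr_ae (ae_of_all _ fun x => ?_)
    show (‖u t x‖ ^ 2) ^ (q / 2 - 1) * _ = ‖u t x‖ ^ (q - 2) * _
    rw [hpw x, show 2 * (q / 2 - 1) = q - 2 by ring]
  rw [eXw] at hbal
  -- `hbal : R ≤ -(q * ν * X) + q / 2 * (q / 2 - 1) / ν * P`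
  -- ### Step 1 (Hölder + Calderón–Zygmund): `P ≤ CP² A`
  have hP_le : P ≤ CP ^ 2 * A := by
    have ha' : 0 < 4 / (q + 2) := by positivity
    have hb' : 0 < (q - 2) / (q + 2) := by
      have : 0 < q - 2 := by linarith
      positivity
    have hab' : 4 / (q + 2) + (q - 2) / (q + 2) = 1 := by field_simp; ring
    -- Hölder with `f = π²`, `g = (‖u‖²)^{q/2−1}`
    have hH := integral_mul_le_rpow_mul_rpow (f := fun x => (p t x - c₀) ^ 2)
      (g := fun x => (‖u t x‖ ^ 2) ^ (q / 2 - 1)) (hπc.pow 2)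
      ((hwc.pow 2).rpow_const fun x => Or.inr (by linarith)) (fun x => sq_nonneg _)
      (fun x => Real.rpow_nonneg (sq_nonneg _) _) ha' hb' hab'
    -- identify the two factors
    have e1 : ∀ x, ((p t x - c₀) ^ 2) ^ (4 / (q + 2))⁻¹ = |p t x - c₀| ^ ((q + 2) / 2) := by
      intro x
      rw [← sq_abs, ← Real.rpow_natCast, ← Real.rpow_mul (abs_nonneg _), inv_div]
      congr 1; push_cast; ring
    have e2 : ∀ x, ((‖u t x‖ ^ 2) ^ (q / 2 - 1)) ^ ((q - 2) / (q + 2))⁻¹ = ‖u t x‖ ^ (q + 2) := by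
      intro x
      rw [hpw x, ← Real.rpow_mul (norm_nonneg _), inv_div]
      congr 1
      rw [show (2 : ℝ) * (q / 2 - 1) = q - 2 by ring, mul_div_assoc', mul_comm (q - 2),
        mul_div_assoc, div_self hq2ne, mul_one]
    simp only [e1, e2] at hH
    -- the pressure bound, squared
    have hπ := hCP hab h t ht
    have hγ0 : 0 < (q + 2) / 2 := by positivity
    have e3 : ∀ x, (‖u t x‖ ^ 2) ^ ((q + 2) / 2) = ‖u t x‖ ^ (q + 2) := by
      intro x; rw [hpw x]; congr 1; ring
    simp only [e3] at hπ
    -- `hπ : (∫ |π|^{γ})^{1/γ} ≤ CP * A^{1/γ}`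
    have hI0 : 0 ≤ ∫ x, |p t x - c₀| ^ ((q + 2) / 2) :=
      integral_nonneg fun x => Real.rpow_nonneg (abs_nonneg _) _
    have h4 : (∫ x, |p t x - c₀| ^ ((q + 2) / 2)) ^ (4 / (q + 2)) ≤ CP ^ 2 * A ^ (4 / (q + 2)) := by
      have e4 : (4 : ℝ) / (q + 2) = 1 / ((q + 2) / 2) * 2 := by field_simp; ring
      have hsq : ((∫ x, |p t x - c₀| ^ ((q + 2) / 2)) ^ (1 / ((q + 2) / 2))) ^ (2 : ℝ) ≤
          (CP * A ^ (1 / ((q + 2) / 2))) ^ (2 : ℝ) :=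
        Real.rpow_le_rpow (Real.rpow_nonneg hI0 _) hπ (by norm_num)
      rw [e4, Real.rpow_mul hI0, Real.rpow_mul hA0]
      calc ((∫ x, |p t x - c₀| ^ ((q + 2) / 2)) ^ (1 / ((q + 2) / 2))) ^ (2 : ℝ)
          ≤ (CP * A ^ (1 / ((q + 2) / 2))) ^ (2 : ℝ) := hsq
        _ = CP ^ 2 * (A ^ (1 / ((q + 2) / 2))) ^ (2 : ℝ) := by
            rw [Real.mul_rpow hCP0 (Real.rpow_nonneg hA0 _)]
            norm_num
    calc P = ∫ x, (p t x - c₀) ^ 2 * (‖u t x‖ ^ 2) ^ (q / 2 - 1) := rfl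
      _ ≤ (∫ x, |p t x - c₀| ^ ((q + 2) / 2)) ^ (4 / (q + 2)) *
            (∫ x, ‖u t x‖ ^ (q + 2)) ^ ((q - 2) / (q + 2)) := hH
      _ ≤ CP ^ 2 * A ^ (4 / (q + 2)) * A ^ ((q - 2) / (q + 2)) :=
          mul_le_mul_of_nonneg_right h4 (Real.rpow_nonneg hA0 _)
      _ = CP ^ 2 * A := by
          rw [mul_assoc, ← Real.rpow_add' hA0 (by rw [hab']; norm_num), hab', Real.rpow_one]
  -- ### Step 2 (interpolation): `A ≤ U^{(q−1)/q} B^{1/q}`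
  have hA_le : A ≤ U ^ ((q - 1) / q) * B ^ (1 / q) := by
    have ha' : 0 < (q - 1) / q := by
      have : 0 < q - 1 := by linarith
      positivity
    have hb' : 0 < 1 / q := by positivity
    have hab' : (q - 1) / q + 1 / q = 1 := by field_simp; ring
    have hH := integral_mul_le_rpow_mul_rpow (f := fun x => ‖u t x‖ ^ (q - 1))
      (g := fun x => ‖u t x‖ ^ (3 : ℝ)) (hwc.rpow_const fun x => Or.inr (by linarith))
      (hwc.rpow_const fun x => Or.inr (by norm_num)) (fun x => Real.rpow_nonneg (norm_nonneg _) _)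
      (fun x => Real.rpow_nonneg (norm_nonneg _) _) ha' hb' hab'
    have e0 : ∀ x, ‖u t x‖ ^ (q - 1) * ‖u t x‖ ^ (3 : ℝ) = ‖u t x‖ ^ (q + 2) := by
      intro x
      rcases (norm_nonneg (u t x)).eq_or_lt with hz | hpos
      · rw [← hz, Real.zero_rpow hq1ne, Real.zero_rpow (by norm_num), zero_mul,
          Real.zero_rpow hq2ne']
      · rw [← Real.rpow_add hpos]; congr 1; ring
    have e1 : ∀ x, (‖u t x‖ ^ (q - 1)) ^ ((q - 1) / q)⁻¹ = ‖u t x‖ ^ q := by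
      intro x
      rw [← Real.rpow_mul (norm_nonneg _), inv_div]
      congr 1
      rw [mul_div_assoc', mul_comm (q - 1), mul_div_assoc, div_self hq1ne, mul_one]
    have e2 : ∀ x, (‖u t x‖ ^ (3 : ℝ)) ^ (1 / q)⁻¹ = ‖u t x‖ ^ (3 * q) := by
      intro x
      rw [← Real.rpow_mul (norm_nonneg _), one_div, inv_inv]
    simp only [e0, e1, e2] at hH
    exact hH
  -- ### Step 3 (weighted Sobolev): `B^{1/q} ≤ (c X)^θ`
  have hB_le : B ^ (1 / q) ≤ (c * X) ^ θ := by
    have hL := hc (u t) hut (hmean t ht)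
    -- `hL : B^{1/3} ≤ c * X`
    have e : B ^ (1 / q) = (B ^ (1 / 3 : ℝ)) ^ θ := by
      rw [← Real.rpow_mul hB0, hθ]
      congr 1; field_simp
    rw [e]
    exact Real.rpow_le_rpow (Real.rpow_nonneg hB0 _) hL hθ0.le
  -- ### Step 4: the pressure term is `≤ (coef/ν) U^{(q−1)/q} X^θ`
  have hcX0 : 0 ≤ c * X := mul_nonneg hc0 hX0
  have hT_le : q / 2 * (q / 2 - 1) / ν * P ≤ coef / ν * (U ^ ((q - 1) / q) * X ^ θ) := by
    have hq' : 0 ≤ q / 2 * (q / 2 - 1) / ν := by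
      have : 0 ≤ q / 2 * (q / 2 - 1) := by nlinarith
      positivity
    have hUe : 0 ≤ U ^ ((q - 1) / q) := Real.rpow_nonneg hU0 _
    calc q / 2 * (q / 2 - 1) / ν * P ≤ q / 2 * (q / 2 - 1) / ν * (CP ^ 2 * A) :=
          mul_le_mul_of_nonneg_left hP_le hq'
      _ ≤ q / 2 * (q / 2 - 1) / ν * (CP ^ 2 * (U ^ ((q - 1) / q) * (c * X) ^ θ)) := by
          refine mul_le_mul_of_nonneg_left (mul_le_mul_of_nonneg_left ?_ (sq_nonneg _)) hq'
          exact hA_le.trans (mul_le_mul_of_nonneg_left hB_le hUe)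
      _ = coef / ν * (U ^ ((q - 1) / q) * X ^ θ) := by
          rw [Real.mul_rpow hc0 hX0, hcoef]
          ring
  -- ### Step 5 (Young): `(coef/ν) U^{(q−1)/q} X^θ ≤ 3νX + K ν^{−(q+3)/(q−3)} U^{(q−1)/(q−3)}`
  have hqν : 0 < q * ν := mul_pos hq0 hν
  set y : ℝ := coef / ν * (q * ν) ^ (-θ) * U ^ ((q - 1) / q) with hy
  have hy0 : 0 ≤ y := by
    rw [hy]
    exact mul_nonneg (mul_nonneg (div_nonneg hcoef0 hν.le) (Real.rpow_nonneg hqν.le _))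
      (Real.rpow_nonneg hU0 _)
  have hsplit : coef / ν * (U ^ ((q - 1) / q) * X ^ θ) = (q * ν * X) ^ θ * y := by
    have e : (q * ν * X) ^ θ = (q * ν) ^ θ * X ^ θ := Real.mul_rpow hqν.le hX0
    have e' : (q * ν) ^ (-θ) * (q * ν) ^ θ = 1 := by
      rw [Real.rpow_neg hqν.le, inv_mul_cancel₀ (Real.rpow_pos_of_pos hqν θ).ne']
    rw [e, hy]
    calc coef / ν * (U ^ ((q - 1) / q) * X ^ θ)
        = coef / ν * (U ^ ((q - 1) / q) * X ^ θ) * ((q * ν) ^ (-θ) * (q * ν) ^ θ) := by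
          rw [e', mul_one]
      _ = (q * ν) ^ θ * X ^ θ * (coef / ν * (q * ν) ^ (-θ) * U ^ ((q - 1) / q)) := by ring
  have hYoung : (q * ν * X) ^ θ * y ≤ θ * (q * ν * X) + (1 - θ) * y ^ (1 / (1 - θ)) :=
    rpow_mul_le_young (by positivity) hy0 hθ0 hθ1
  have hθq : θ * (q * ν * X) = 3 * ν * X := by
    rw [hθ]; field_simp
  -- the power of `y`
  have hy_pow : (1 - θ) * y ^ (1 / (1 - θ)) =
      K * ν ^ (-((q + 3) / (q - 3))) * U ^ ((q - 1) / (q - 3)) := by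
    rw [h1θ', hK]
    -- `y = (coef q^{−θ}) · ν^{−(1+θ)} · U^{(q−1)/q}`
    have hν1 : coef / ν * (q * ν) ^ (-θ) = coef * q ^ (-θ) * ν ^ (-(1 + θ)) := by
      rw [Real.mul_rpow hq0.le hν.le, neg_add, Real.rpow_add hν, Real.rpow_neg hν.le 1,
        Real.rpow_one]
      field_simp
    have hy' : y = coef * q ^ (-θ) * (ν ^ (-(1 + θ)) * U ^ ((q - 1) / q)) := by
      rw [hy, hν1]; ring
    have hcq0 : 0 ≤ coef * q ^ (-θ) := mul_nonneg hcoef0 (Real.rpow_nonneg hq0.le _)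
    have hνp0 : 0 ≤ ν ^ (-(1 + θ)) := Real.rpow_nonneg hν.le _
    have hUp0 : 0 ≤ U ^ ((q - 1) / q) := Real.rpow_nonneg hU0 _
    rw [hy', Real.mul_rpow hcq0 (mul_nonneg hνp0 hUp0), Real.mul_rpow hνp0 hUp0,
      ← Real.rpow_mul hν.le, ← Real.rpow_mul hU0]
    have eν : -(1 + θ) * (q / (q - 3)) = -((q + 3) / (q - 3)) := by
      rw [hθ]; field_simp
    have eU : (q - 1) / q * (q / (q - 3)) = (q - 1) / (q - 3) := by
      field_simp
    rw [eν, eU]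
    ring
  -- ### assemble
  have hfinal : q / 2 * (q / 2 - 1) / ν * P ≤
      3 * ν * X + K * ν ^ (-((q + 3) / (q - 3))) * U ^ ((q - 1) / (q - 3)) := by
    calc q / 2 * (q / 2 - 1) / ν * P ≤ coef / ν * (U ^ ((q - 1) / q) * X ^ θ) := hT_le
      _ = (q * ν * X) ^ θ * y := hsplit
      _ ≤ θ * (q * ν * X) + (1 - θ) * y ^ (1 / (1 - θ)) := hYoung
      _ = 3 * ν * X + K * ν ^ (-((q + 3) / (q - 3))) * U ^ ((q - 1) / (q - 3)) := by
          rw [hθq, hy_pow]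
  have : R ≤ -(q * ν * X) + (3 * ν * X + K * ν ^ (-((q + 3) / (q - 3))) * U ^ ((q - 1) / (q - 3))) :=
    hbal.trans (by linarith)
  calc R ≤ -(q * ν * X) + (3 * ν * X + K * ν ^ (-((q + 3) / (q - 3))) * U ^ ((q - 1) / (q - 3))) :=
        this
    _ = -((q - 3) * ν * X) + K * ν ^ (-((q + 3) / (q - 3))) * U ^ ((q - 1) / (q - 3)) := by ring

/-- **The rate-of-growth bound for `‖u‖_{L^q}`, printed shape** (Bleitner–Protas 2026, (5);
Robinson–Sadowski 2014, proof of Theorem 8): with `K = K(q, d)` as in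
`Torus.exists_deriv_integral_norm_rpow_le_of_three_lt`, every one-sided derivative `R` of
`s ↦ ∫‖u(s)‖^q = ‖u(s)‖_q^q` along a classical mean-zero solution on `[a, b] × T³` satisfies
`R ≤ K ν^{−(q+3)/(q−3)} (‖u(t)‖_q^q)^{(q−1)/(q−3)}`, i.e.
`(1/q) d/dt‖u‖_q^q ≤ (K/q) ν^{−(q+3)/(q−3)} ‖u‖_q^{q(q−1)/(q−3)}`.
[cite: BleitnerProtas2026, eq. (5)] [cite: RobinsonSadowski2014, Theorem 8 (proof)] -/
theorem Torus.exists_deriv_integral_norm_rpow_le_of_three_lt' (hd : Fintype.card d = 3) {q : ℝ}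
    (hq : 3 < q) :
    ∃ K : ℝ, 0 ≤ K ∧ ∀ {ν a b : ℝ}, 0 < ν → a < b →
      ∀ {u : ℝ → UnitAddTorus d → EuclideanSpace ℝ d} {p : ℝ → UnitAddTorus d → ℝ},
        Torus.IsClassicalNSSolutionOn (Icc a b) ν 0 u p →
        (∀ t ∈ Icc a b, Torus.HasZeroMean (u t)) →
        ∀ t ∈ Icc a b, ∀ R : ℝ,
          HasDerivWithinAt (fun s => ∫ x, ‖u s x‖ ^ q) R (Icc a b) t →
          R ≤ K * ν ^ (-((q + 3) / (q - 3))) * (∫ x, ‖u t x‖ ^ q) ^ ((q - 1) / (q - 3)) := by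
  obtain ⟨K, hK0, hK⟩ := Torus.exists_deriv_integral_norm_rpow_le_of_three_lt (d := d) hd hq
  refine ⟨K, hK0, fun {ν a b} hν hab {u p} h hmean t ht R hR => ?_⟩
  have h1 := hK hν hab h hmean t ht R hR
  have hX0 : 0 ≤ (q - 3) * ν * ∫ x, ‖u t x‖ ^ (q - 2) * ∑ k, ‖Torus.partialDeriv k (u t) x‖ ^ 2 := by
    have : 0 ≤ ∫ x, ‖u t x‖ ^ (q - 2) * ∑ k, ‖Torus.partialDeriv k (u t) x‖ ^ 2 :=
      integral_nonneg fun x => mul_nonneg (Real.rpow_nonneg (norm_nonneg _) _)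
        (Finset.sum_nonneg fun k _ => sq_nonneg _)
    have hq3 : 0 ≤ q - 3 := by linarith
    exact mul_nonneg (mul_nonneg hq3 hν.le) this
  linarith

/-! ## 3. Theorem 8 (lifespan in `L^q`) and Corollary 9 (blow-up rate) in continuation form -/

namespace LebesgueNormRate

omit [DecidableEq d] in
/-- `s ↦ ∫‖u(s)‖^q` is differentiable within `[a, b]` along a jointly smooth velocity (`q ≥ 2`):
dominated differentiation of `(‖u‖²)^{q/2}` (the weight `y ↦ y^{q/2}` is `C¹` for `q ≥ 2`).
[folklore] -/
private theorem hasDerivWithinAt_integral_norm_rpow {a b : ℝ}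
    {u : ℝ → UnitAddTorus d → EuclideanSpace ℝ d} (hu : Torus.IsSmoothSpaceTimeOn (Icc a b) u)
    (hab : a < b) {q : ℝ} (hq : 2 ≤ q) {t : ℝ} (ht : t ∈ Icc a b) :
    ∃ R : ℝ, HasDerivWithinAt (fun s => ∫ x, ‖u s x‖ ^ q) R (Icc a b) t := by
  set S : Set ℝ := Icc a b with hS
  have hU : UniqueDiffOn ℝ S := uniqueDiffOn_Icc hab
  -- `Q = ‖u‖²` and its time derivative are jointly smooth
  set Q : ℝ → UnitAddTorus d → ℝ := fun s x => ‖u s x‖ ^ 2 with hQ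
  have hQst : Torus.IsSmoothSpaceTimeOn S Q := by
    have h1 := hu.inner hu
    have e : Q = fun s x => ⟪u s x, u s x⟫ := by
      funext s x; rw [hQ, real_inner_self_eq_norm_sq]
    rw [e]; exact h1
  set Q' : ℝ → UnitAddTorus d → ℝ := Torus.timeDerivWithin S Q with hQ'
  have hQ'st : Torus.IsSmoothSpaceTimeOn S Q' := hQst.timeDerivWithin hU
  obtain ⟨B₁, hB₁⟩ := hQst.exists_norm_le_of_isCompact isCompact_Icc subset_rfl
  obtain ⟨B₂, hB₂⟩ := hQ'st.exists_norm_le_of_isCompact isCompact_Icc subset_rfl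
  have hB₁0 : 0 ≤ B₁ := (norm_nonneg _).trans (hB₁ t ht (0 : UnitAddTorus d))
  have hB₂0 : 0 ≤ B₂ := (norm_nonneg _).trans (hB₂ t ht (0 : UnitAddTorus d))
  have hr0 : 0 ≤ q / 2 - 1 := by linarith
  have h1q : (1 : ℝ) ≤ q / 2 := by linarith
  set F : ℝ → UnitAddTorus d → ℝ := fun s x => (Q s x) ^ (q / 2) with hF
  set F' : ℝ → UnitAddTorus d → ℝ := fun s x => q / 2 * (Q s x) ^ (q / 2 - 1) * Q' s x with hF'
  have hQ0 : ∀ s x, 0 ≤ Q s x := fun s x => by rw [hQ]; positivity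
  have hderiv : ∀ s ∈ S, ∀ x, HasDerivWithinAt (F · x) (F' s x) S s := by
    intro s hs x
    have h1 : HasDerivWithinAt (fun τ => Q τ x) (Q' s x) S s := hQst.hasDerivWithinAt_slice hs x
    have h2 := (Real.hasDerivAt_rpow_const (p := q / 2) (x := Q s x) (Or.inr h1q)).comp_hasDerivWithinAt s h1
    have e : F' s x = q / 2 * Q s x ^ (q / 2 - 1) * Q' s x := rfl
    rw [e]
    exact h2
  have hF_int : ∀ s ∈ S, Integrable (F s) volume := fun s hs =>
    (((hQst.isSmooth_slice hs).continuous).rpow_const fun x => Or.inr (by linarith)).integrable_unitAddTorus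
  have hbound : ∀ᶠ s in 𝓝[S] t, ∀ x, ‖F' s x‖ ≤ q / 2 * B₁ ^ (q / 2 - 1) * B₂ := by
    refine eventually_nhdsWithin_of_forall fun s hs x => ?_
    have hQle : Q s x ≤ B₁ := by
      have := hB₁ s hs x
      rw [Real.norm_of_nonneg (hQ0 s x)] at this
      exact this
    have h1 : Q s x ^ (q / 2 - 1) ≤ B₁ ^ (q / 2 - 1) := Real.rpow_le_rpow (hQ0 s x) hQle hr0
    have h2 : |Q' s x| ≤ B₂ := by
      have := hB₂ s hs x
      rwa [Real.norm_eq_abs] at this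
    rw [hF', Real.norm_eq_abs]
    simp only
    rw [abs_mul, abs_mul, abs_of_nonneg (by linarith : (0 : ℝ) ≤ q / 2),
      abs_of_nonneg (Real.rpow_nonneg (hQ0 s x) _)]
    have hq2 : (0 : ℝ) ≤ q / 2 := by linarith
    calc q / 2 * Q s x ^ (q / 2 - 1) * |Q' s x| ≤ q / 2 * B₁ ^ (q / 2 - 1) * B₂ := by
          gcongr
    _ = q / 2 * B₁ ^ (q / 2 - 1) * B₂ := rfl
  have hF'_meas : AEStronglyMeasurable (F' t) volume := by
    have hc : Continuous (F' t) :=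
      ((continuous_const.mul (((hQst.isSmooth_slice ht).continuous).rpow_const
        fun x => Or.inr hr0)).mul (hQ'st.isSmooth_slice ht).continuous)
    exact hc.aestronglyMeasurable
  have hmain := Torus.hasDerivWithinAt_integral_of_convex (μ := volume) (convex_Icc a b) ht
    hF_int hderiv hbound hF'_meas
  refine ⟨∫ x, F' t x, ?_⟩
  have e : (fun s => ∫ x, ‖u s x‖ ^ q) = fun s => ∫ x, F s x := by
    funext s
    refine integral_congr_ae (ae_of_all _ fun x => ?_)
    show ‖u s x‖ ^ q = (‖u s x‖ ^ 2) ^ (q / 2)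
    rw [← Real.rpow_natCast, ← Real.rpow_mul (norm_nonneg _)]
    congr 1; push_cast; ring
  rw [e]
  exact hmain

/-- **Comparison for `Ẋ ≤ C X^γ`, `γ > 1`.** If `X ≥ 0` has one-sided derivatives `X'` within
`[t₀, t₁]` with `X' ≤ C X^γ` (`C ≥ 0`), then for every `δ > 0` and `s ∈ [t₀, t₁]`,
`(X(t₀) + δ)^{1−γ} − (γ − 1) C (s − t₀) ≤ (X(s) + δ)^{1−γ}`
(the function `(X + δ)^{1−γ} + (γ−1) C (s − t₀)` is nondecreasing). [folklore] -/
private theorem rpow_one_sub_comparison {X X' : ℝ → ℝ} {t₀ t₁ C γ δ : ℝ} (hC : 0 ≤ C)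
    (hγ : 1 < γ) (hδ : 0 < δ) (hX0 : ∀ s ∈ Icc t₀ t₁, 0 ≤ X s)
    (hder : ∀ s ∈ Icc t₀ t₁, HasDerivWithinAt X (X' s) (Icc t₀ t₁) s)
    (hle : ∀ s ∈ Icc t₀ t₁, X' s ≤ C * X s ^ γ) {s : ℝ} (hs : s ∈ Icc t₀ t₁) :
    (X t₀ + δ) ^ (1 - γ) - (γ - 1) * C * (s - t₀) ≤ (X s + δ) ^ (1 - γ) := by
  set Z : ℝ → ℝ := fun τ => (X τ + δ) ^ (1 - γ) + (γ - 1) * C * (τ - t₀) with hZ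
  set Z' : ℝ → ℝ := fun τ => X' τ * (1 - γ) * (X τ + δ) ^ (1 - γ - 1) + (γ - 1) * C with hZ'
  have hpos : ∀ τ ∈ Icc t₀ t₁, 0 < X τ + δ := fun τ hτ => by linarith [hX0 τ hτ]
  have hZder : ∀ τ ∈ Icc t₀ t₁, HasDerivWithinAt Z (Z' τ) (Icc t₀ t₁) τ := by
    intro τ hτ
    have h1 : HasDerivWithinAt (fun r => X r + δ) (X' τ) (Icc t₀ t₁) τ := (hder τ hτ).add_const δ
    have h2 := h1.rpow_const (p := 1 - γ) (Or.inl (hpos τ hτ).ne')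
    have h3 : HasDerivWithinAt (fun r => (γ - 1) * C * (r - t₀)) ((γ - 1) * C) (Icc t₀ t₁) τ := by
      have := ((hasDerivAt_id τ).sub_const t₀).const_mul ((γ - 1) * C)
      rw [mul_one] at this
      exact this.hasDerivWithinAt
    exact h2.add h3
  have hZ'0 : ∀ τ ∈ interior (Icc t₀ t₁), 0 ≤ Z' τ := by
    intro τ hτ
    have hτ' : τ ∈ Icc t₀ t₁ := interior_subset hτ
    have hp := hpos τ hτ'
    -- `X' ≤ C X^γ ≤ C (X+δ)^γ`
    have hXγ : X τ ^ γ ≤ (X τ + δ) ^ γ :=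
      Real.rpow_le_rpow (hX0 τ hτ') (by linarith) (by linarith)
    have h1 : X' τ ≤ C * (X τ + δ) ^ γ := (hle τ hτ').trans (mul_le_mul_of_nonneg_left hXγ hC)
    -- multiply by the nonnegative `(γ−1)(X+δ)^{−γ}`
    have hw0 : 0 ≤ (γ - 1) * (X τ + δ) ^ (1 - γ - 1) :=
      mul_nonneg (by linarith) (Real.rpow_nonneg hp.le _)
    have h2 : X' τ * ((γ - 1) * (X τ + δ) ^ (1 - γ - 1)) ≤
        C * (X τ + δ) ^ γ * ((γ - 1) * (X τ + δ) ^ (1 - γ - 1)) :=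
      mul_le_mul_of_nonneg_right h1 hw0
    have e : (X τ + δ) ^ γ * (X τ + δ) ^ (1 - γ - 1) = 1 := by
      rw [← Real.rpow_add hp, show γ + (1 - γ - 1) = 0 by ring, Real.rpow_zero]
    have h3 : C * (X τ + δ) ^ γ * ((γ - 1) * (X τ + δ) ^ (1 - γ - 1)) = (γ - 1) * C := by
      calc C * (X τ + δ) ^ γ * ((γ - 1) * (X τ + δ) ^ (1 - γ - 1))
          = (γ - 1) * C * ((X τ + δ) ^ γ * (X τ + δ) ^ (1 - γ - 1)) := by ring
        _ = (γ - 1) * C := by rw [e, mul_one]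
    rw [hZ']
    show 0 ≤ X' τ * (1 - γ) * (X τ + δ) ^ (1 - γ - 1) + (γ - 1) * C
    nlinarith [h2, h3]
  have hZcont : ContinuousOn Z (Icc t₀ t₁) := fun τ hτ => (hZder τ hτ).continuousWithinAt
  have hmono : MonotoneOn Z (Icc t₀ t₁) :=
    monotoneOn_of_hasDerivWithinAt_nonneg (convex_Icc t₀ t₁) hZcont
      (fun τ hτ => ((hZder τ (interior_subset hτ)).mono interior_subset)) hZ'0
  have ht₀ : t₀ ∈ Icc t₀ t₁ := ⟨le_rfl, hs.1.trans hs.2⟩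
  have h := hmono ht₀ hs hs.1
  simp only [hZ, sub_self, mul_zero, add_zero] at h
  linarith

/-- From the comparison inequality to an upper bound: if `0 < m ≤ (X + δ)^{1−γ}` then
`X + δ ≤ m^{1/(1−γ)}`. [folklore] -/
private theorem add_le_rpow_of_le_rpow_one_sub {X δ γ m : ℝ} (hγ : 1 < γ) (hXδ : 0 < X + δ)
    (hm : 0 < m) (h : m ≤ (X + δ) ^ (1 - γ)) : X + δ ≤ m ^ (1 / (1 - γ)) := by
  have hneg : 1 / (1 - γ) ≤ 0 := by
    rw [one_div]; exact inv_nonpos.2 (by linarith)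
  have h1 : ((X + δ) ^ (1 - γ)) ^ (1 / (1 - γ)) ≤ m ^ (1 / (1 - γ)) :=
    Real.rpow_le_rpow_of_nonpos hm h hneg
  have e : ((X + δ) ^ (1 - γ)) ^ (1 / (1 - γ)) = X + δ := by
    rw [← Real.rpow_mul hXδ.le, mul_one_div_cancel (by linarith : (1 : ℝ) - γ ≠ 0), Real.rpow_one]
  rw [e] at h1
  exact h1

/-- Choice of the regularisation parameter: if `L · X^{e} < 1` (`e > 0`) then
`L · (X + δ)^{e} < 1` for some `δ > 0` (continuity of `y ↦ y^e`, `e > 0`). [folklore] -/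
private theorem exists_pos_mul_add_rpow_lt_one {L X e : ℝ} (he : 0 < e)
    (h : L * X ^ e < 1) : ∃ δ : ℝ, 0 < δ ∧ L * (X + δ) ^ e < 1 := by
  have hc : ContinuousAt (fun δ : ℝ => L * (X + δ) ^ e) 0 := by
    have h1 : ContinuousAt (fun δ : ℝ => X + δ) 0 := (continuous_const.add continuous_id).continuousAt
    have h2 : ContinuousAt (fun y : ℝ => y ^ e) (X + 0) :=
      Real.continuousAt_rpow_const _ _ (Or.inr he.le)
    exact continuousAt_const.mul (h2.comp h1)
  have h0 : (fun δ : ℝ => L * (X + δ) ^ e) 0 < 1 := by simpa using h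
  have hev : ∀ᶠ δ in 𝓝 (0 : ℝ), L * (X + δ) ^ e < 1 := hc.eventually (gt_mem_nhds h0)
  obtain ⟨ε, hε, hball⟩ := Metric.eventually_nhds_iff.1 hev
  refine ⟨ε / 2, by positivity, hball ?_⟩
  rw [Real.dist_eq, sub_zero, abs_of_pos (by positivity)]
  linarith

end LebesgueNormRate

/-- **Robinson–Sadowski 2014, Theorem 8, in continuation form on `T³` (lifespan in `L^q`).**
Printed: "There exists an absolute constant `c > 0` such that if `∇·u₀ = 0`, `u₀ ∈ L^p`, `p > 3`,
`T = c‖u₀‖_{L^p}^{−2p/(p−3)}`, and `u` is the solution of the Navier–Stokes equations with initial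
condition `u₀`, then `u` is regular on the time interval `[0, T)`" (proof: `X = ‖u‖_{L^p}^p`
satisfies `Ẋ ≤ cX^{(p−1)/(p−3)}`, so `X` stays finite as long as
`1 − X(0)^{γ−1}(γ−1)c t > 0`, `γ = (p−1)/(p−3)`). Here, with the viscosity restored
(`ν^{(q+3)/(q−3)}`, Bleitner–Protas 2026 (5)) and for classical solutions on the unit torus: for
`3 < q` there is `c = c(q, d) > 0` such that every classical solution of the unforced Navier–Stokes
equations (`ν > 0`) on `[0, T) × T^d`, `card d = 3`, `T > 0`, with mean-zero velocity slices and
`T · (∫‖u(0)‖^q)^{2/(q−3)} < c ν^{(q+3)/(q−3)}`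
has `∫‖u(t)‖^q` bounded on `[0, T)` (comparison for `Ẋ ≤ K ν^{−(q+3)/(q−3)} X^{(q−1)/(q−3)}`) and
therefore continues to a classical solution with mean-zero slices on some `[0, T'] × T^d`,
`T' > T`, equal to `u` on `[0, T)` (Serrin's condition with `s = q`, tree
`Torus.classicalNS_continuation_of_Ls_rpow_integral_le`). The printed local EXISTENCE in `L^p` is
not asserted. [cite: RobinsonSadowski2014, Theorem 8] -/
theorem Torus.classicalNS_continuation_of_lqNorm_lifespan (hd : Fintype.card d = 3) {q : ℝ}
    (hq : 3 < q) :
    ∃ c : ℝ, 0 < c ∧ ∀ {ν T : ℝ}, 0 < ν → 0 < T →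
      ∀ {u : ℝ → UnitAddTorus d → EuclideanSpace ℝ d} {p : ℝ → UnitAddTorus d → ℝ},
        Torus.IsClassicalNSSolutionOn (Ico 0 T) ν 0 u p →
        (∀ t ∈ Ico 0 T, Torus.HasZeroMean (u t)) →
        T * (∫ x, ‖u 0 x‖ ^ q) ^ (2 / (q - 3)) < c * ν ^ ((q + 3) / (q - 3)) →
        ∃ T' : ℝ, T < T' ∧ ∃ (u' : ℝ → UnitAddTorus d → EuclideanSpace ℝ d)
          (p' : ℝ → UnitAddTorus d → ℝ), Torus.IsClassicalNSSolutionOn (Icc 0 T') ν 0 u' p' ∧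
            (∀ t ∈ Icc 0 T', Torus.HasZeroMean (u' t)) ∧ ∀ t ∈ Ico 0 T, u' t = u t := by
  obtain ⟨K, hK0, hK⟩ := Torus.exists_deriv_integral_norm_rpow_le_of_three_lt' (d := d) hd hq
  have hq0 : 0 < q := by linarith
  have hq3 : 0 < q - 3 := by linarith
  set K₁ : ℝ := K + 1 with hK₁
  have hK₁0 : 0 < K₁ := by rw [hK₁]; linarith
  -- `γ − 1 = 2/(q−3)`, `1 − γ = −2/(q−3)`
  set γ : ℝ := (q - 1) / (q - 3) with hγ
  have hγ1 : γ - 1 = 2 / (q - 3) := by rw [hγ]; field_simp; ring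
  have hγgt : 1 < γ := by
    have : 0 < 2 / (q - 3) := by positivity
    linarith
  set e : ℝ := (q + 3) / (q - 3) with he
  refine ⟨1 / ((γ - 1) * K₁), by rw [hγ1]; positivity, fun {ν T} hν hT {u p} h hmean hsmall => ?_⟩
  set C : ℝ := K₁ * ν ^ (-e) with hC
  have hCpos : 0 < C := by rw [hC]; exact mul_pos hK₁0 (Real.rpow_pos_of_pos hν _)
  have hC0 : 0 ≤ C := hCpos.le
  have hq2 : (2 : ℝ) ≤ q := by linarith
  set X : ℝ → ℝ := fun s => ∫ x, ‖u s x‖ ^ q with hX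
  have hXnn : ∀ s, 0 ≤ X s := fun s => integral_nonneg fun x => Real.rpow_nonneg (norm_nonneg _) _
  -- the smallness hypothesis: `(γ−1) C T X(0)^{γ−1} < 1`
  have hsmall' : (γ - 1) * C * T * X 0 ^ (γ - 1) < 1 := by
    rw [hγ1] at hsmall ⊢
    have hνe : 0 < ν ^ e := Real.rpow_pos_of_pos hν e
    have h1 : T * X 0 ^ (2 / (q - 3)) < 1 / (2 / (q - 3) * K₁) * ν ^ e := hsmall
    have h2 : 2 / (q - 3) * K₁ * ν ^ (-e) * (T * X 0 ^ (2 / (q - 3))) <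
        2 / (q - 3) * K₁ * ν ^ (-e) * (1 / (2 / (q - 3) * K₁) * ν ^ e) :=
      mul_lt_mul_of_pos_left h1 (by rw [hK₁]; exact mul_pos (by positivity) (Real.rpow_pos_of_pos hν _))
    have e3 : 2 / (q - 3) * K₁ * ν ^ (-e) * (1 / (2 / (q - 3) * K₁) * ν ^ e) = 1 := by
      rw [Real.rpow_neg hν.le]
      field_simp
    rw [e3] at h2
    calc 2 / (q - 3) * C * T * X 0 ^ (2 / (q - 3))
        = 2 / (q - 3) * K₁ * ν ^ (-e) * (T * X 0 ^ (2 / (q - 3))) := by rw [hC]; ring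
      _ < 1 := h2
  -- choose `δ > 0` with `(γ−1) C T (X 0 + δ)^{γ−1} < 1`
  obtain ⟨δ, hδ, hδ1⟩ := exists_pos_mul_add_rpow_lt_one (L := (γ - 1) * C * T)
    (by linarith : 0 < γ - 1) hsmall'
  have hX0δ : 0 < X 0 + δ := by linarith [hXnn 0]
  -- `m = (X 0 + δ)^{1−γ} − (γ−1) C T > 0`
  set m : ℝ := (X 0 + δ) ^ (1 - γ) - (γ - 1) * C * T with hm
  have hLpos : 0 < (γ - 1) * C * T := mul_pos (mul_pos (by linarith) hCpos) hT
  have hm0 : 0 < m := by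
    have hp : 0 < (X 0 + δ) ^ (γ - 1) := Real.rpow_pos_of_pos hX0δ _
    have e1 : (X 0 + δ) ^ (1 - γ) = ((X 0 + δ) ^ (γ - 1))⁻¹ := by
      rw [← Real.rpow_neg hX0δ.le, neg_sub]
    have h3 : (γ - 1) * C * T < ((X 0 + δ) ^ (γ - 1))⁻¹ := by
      rw [← one_div]
      have e2 : (γ - 1) * C * T =
          ((γ - 1) * C * T * (X 0 + δ) ^ (γ - 1)) / (X 0 + δ) ^ (γ - 1) := by
        field_simp
      rw [e2]
      exact div_lt_div_of_pos_right hδ1 hp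
    rw [hm, e1]
    linarith
  -- uniform bound `X t + δ ≤ M` on `[0, T)`
  set M : ℝ := m ^ (1 / (1 - γ)) with hM
  have hbound : ∀ t ∈ Ico 0 T, X t ≤ M := by
    intro t ht
    have hcomp : (X 0 + δ) ^ (1 - γ) - (γ - 1) * C * (t - 0) ≤ (X t + δ) ^ (1 - γ) := by
      rcases ht.1.eq_or_lt with h0 | h0t
      · rw [← h0]; simp
      · have hsub : Icc 0 t ⊆ Ico 0 T := fun s hs => ⟨hs.1, hs.2.trans_lt ht.2⟩
        have h' : Torus.IsClassicalNSSolutionOn (Icc 0 t) ν 0 u p :=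
          h.mono hsub (uniqueDiffOn_Icc h0t)
        -- derivatives on `[0, t]`
        have hder : ∀ s ∈ Icc 0 t, ∃ R, HasDerivWithinAt X R (Icc 0 t) s := fun s hs =>
          hasDerivWithinAt_integral_norm_rpow h'.smooth_velocity h0t hq2 hs
        choose! Xd hXd using hder
        refine rpow_one_sub_comparison (X' := Xd) hC0 hγgt hδ (fun s _ => hXnn s) hXd
          (fun s hs => ?_) ⟨h0t.le, le_rfl⟩
        have h1 := hK hν h0t h' (fun s hs => hmean s (hsub hs)) s hs (Xd s) (hXd s hs)
        rw [hγ, hC]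
        calc Xd s ≤ K * ν ^ (-((q + 3) / (q - 3))) * X s ^ ((q - 1) / (q - 3)) := h1
          _ ≤ K₁ * ν ^ (-e) * X s ^ ((q - 1) / (q - 3)) := by
              have hXγ : 0 ≤ X s ^ ((q - 1) / (q - 3)) := Real.rpow_nonneg (hXnn s) _
              have hνe0 : 0 ≤ ν ^ (-e) := Real.rpow_nonneg hν.le _
              have hKK : K ≤ K₁ := by rw [hK₁]; linarith
              rw [he] at hνe0 ⊢
              exact mul_le_mul_of_nonneg_right (mul_le_mul_of_nonneg_right hKK hνe0) hXγ
    have hmt : m ≤ (X 0 + δ) ^ (1 - γ) - (γ - 1) * C * (t - 0) := by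
      rw [hm, sub_zero]
      have : (γ - 1) * C * t ≤ (γ - 1) * C * T :=
        mul_le_mul_of_nonneg_left ht.2.le (mul_nonneg (by linarith) hC0)
      linarith
    have hXtδ : 0 < X t + δ := by linarith [hXnn t]
    have := add_le_rpow_of_le_rpow_one_sub hγgt hXtδ hm0 (hmt.trans hcomp)
    linarith
  -- Serrin's condition with the constant majorant `N = M^{1/q}`
  have hM0 : 0 ≤ M := by rw [hM]; exact Real.rpow_nonneg hm0.le _
  refine Torus.classicalNS_continuation_of_Ls_rpow_integral_le hd hν hT hq h hmean
    (N := fun _ => M ^ (1 / q)) continuousOn_const (fun _ _ => Real.rpow_nonneg hM0 _)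
    (fun t ht => Real.rpow_le_rpow (hXnn t) (hbound t ht) (by positivity))
    (I := T * (M ^ (1 / q)) ^ (2 * q / (q - 3))) fun t ht => ?_
  rw [intervalIntegral.integral_const, smul_eq_mul, sub_zero]
  exact mul_le_mul_of_nonneg_right ht.2.le (Real.rpow_nonneg (Real.rpow_nonneg hM0 _) _)

/-- **Robinson–Sadowski 2014, Corollary 9 (necessary blow-up rate in `L^p`), on `T³`.** Printed:
"There exists an absolute constant `c > 0` such that if `τ > 0` is a blow up time for a solution
`u` of the Navier–Stokes equations then `‖u(τ − t)‖_{L^p} ≥ c t^{−(p−3)/(2p)}`" (Leray 1934; Giga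
1986; there from Theorem 8). Here, for classical solutions of the unforced Navier–Stokes equations
(`ν > 0`) on `[a, T) × T^d`, `card d = 3`, with mean-zero velocity slices, blow-up being
UNBOUNDEDNESS of `t ↦ ∫‖u(t)‖^q` on `[a, T)`: for `3 < q` there is `c = c(q, d) > 0` with
`(c ν^{(q+3)/(q−3)} / (T − t))^{(q−3)/(2q)} ≤ (∫‖u(t)‖^q)^{1/q} = ‖u(t)‖_{L^q}` for every
`t ∈ [a, T)`, i.e. `‖u(t)‖_{L^q} ≥ c' ν^{(q+3)/(2q)} (T − t)^{−(q−3)/(2q)}` (the `ν`-scaling of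
Leray's rate). Proof: otherwise the comparison for `Ẋ ≤ Kν^{−(q+3)/(q−3)}X^{(q−1)/(q−3)}` from `t`
bounds `X` on `[t, T)`, and `X` is bounded on `[a, t]` by continuity.
[cite: RobinsonSadowski2014, Corollary 9] -/
theorem Torus.lqNorm_blowup_rate (hd : Fintype.card d = 3) {q : ℝ} (hq : 3 < q) :
    ∃ c : ℝ, 0 < c ∧ ∀ {ν a T : ℝ}, 0 < ν →
      ∀ {u : ℝ → UnitAddTorus d → EuclideanSpace ℝ d} {p : ℝ → UnitAddTorus d → ℝ},
        Torus.IsClassicalNSSolutionOn (Ico a T) ν 0 u p →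
        (∀ t ∈ Ico a T, Torus.HasZeroMean (u t)) →
        ¬ BddAbove ((fun t => ∫ x, ‖u t x‖ ^ q) '' Ico a T) →
        ∀ t ∈ Ico a T,
          (c * ν ^ ((q + 3) / (q - 3)) / (T - t)) ^ ((q - 3) / (2 * q)) ≤
            (∫ x, ‖u t x‖ ^ q) ^ (1 / q) := by
  obtain ⟨K, hK0, hK⟩ := Torus.exists_deriv_integral_norm_rpow_le_of_three_lt' (d := d) hd hq
  have hq0 : 0 < q := by linarith
  have hq3 : 0 < q - 3 := by linarith
  set K₁ : ℝ := K + 1 with hK₁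
  have hK₁0 : 0 < K₁ := by rw [hK₁]; linarith
  set γ : ℝ := (q - 1) / (q - 3) with hγ
  have hγ1 : γ - 1 = 2 / (q - 3) := by rw [hγ]; field_simp; ring
  have hγgt : 1 < γ := by
    have : 0 < 2 / (q - 3) := by positivity
    linarith
  set e : ℝ := (q + 3) / (q - 3) with he
  refine ⟨1 / ((γ - 1) * K₁), by rw [hγ1]; positivity, fun {ν a T} hν {u p} h hmean hunb t ht => ?_⟩
  set C : ℝ := K₁ * ν ^ (-e) with hC
  have hCpos : 0 < C := by rw [hC]; exact mul_pos hK₁0 (Real.rpow_pos_of_pos hν _)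
  have hq2 : (2 : ℝ) ≤ q := by linarith
  set X : ℝ → ℝ := fun s => ∫ x, ‖u s x‖ ^ q with hX
  have hXnn : ∀ s, 0 ≤ X s := fun s => integral_nonneg fun x => Real.rpow_nonneg (norm_nonneg _) _
  have htT : 0 < T - t := by linarith [ht.2]
  -- ### key claim: `1 ≤ (γ−1) C (T−t) X(t)^{γ−1}`
  have hkey : 1 ≤ (γ - 1) * C * (T - t) * X t ^ (γ - 1) := by
    by_contra hlt
    rw [not_le] at hlt
    obtain ⟨δ, hδ, hδ1⟩ := exists_pos_mul_add_rpow_lt_one (L := (γ - 1) * C * (T - t))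
      (by linarith : 0 < γ - 1) hlt
    have hXtδ : 0 < X t + δ := by linarith [hXnn t]
    have hLpos : 0 < (γ - 1) * C * (T - t) := mul_pos (mul_pos (by linarith) hCpos) htT
    set m : ℝ := (X t + δ) ^ (1 - γ) - (γ - 1) * C * (T - t) with hm
    have hm0 : 0 < m := by
      have hp : 0 < (X t + δ) ^ (γ - 1) := Real.rpow_pos_of_pos hXtδ _
      have e1 : (X t + δ) ^ (1 - γ) = ((X t + δ) ^ (γ - 1))⁻¹ := by
        rw [← Real.rpow_neg hXtδ.le, neg_sub]
      have h3 : (γ - 1) * C * (T - t) < ((X t + δ) ^ (γ - 1))⁻¹ := by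
        rw [← one_div]
        have e2 : (γ - 1) * C * (T - t) =
            ((γ - 1) * C * (T - t) * (X t + δ) ^ (γ - 1)) / (X t + δ) ^ (γ - 1) := by
          field_simp
        rw [e2]
        exact div_lt_div_of_pos_right hδ1 hp
      rw [hm, e1]; linarith
    set M : ℝ := m ^ (1 / (1 - γ)) with hM
    -- bound on `[t, T)`
    have hright : ∀ s ∈ Ico t T, X s ≤ M := by
      intro s hs
      have hcomp : (X t + δ) ^ (1 - γ) - (γ - 1) * C * (s - t) ≤ (X s + δ) ^ (1 - γ) := by
        rcases hs.1.eq_or_lt with h0 | hts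
        · rw [← h0]; simp
        · have hsub : Icc t s ⊆ Ico a T := fun r hr => ⟨ht.1.trans hr.1, hr.2.trans_lt hs.2⟩
          have h' : Torus.IsClassicalNSSolutionOn (Icc t s) ν 0 u p :=
            h.mono hsub (uniqueDiffOn_Icc hts)
          have hder : ∀ r ∈ Icc t s, ∃ R, HasDerivWithinAt X R (Icc t s) r := fun r hr =>
            hasDerivWithinAt_integral_norm_rpow h'.smooth_velocity hts hq2 hr
          choose! Xd hXd using hder
          refine rpow_one_sub_comparison (X' := Xd) hCpos.le hγgt hδ (fun r _ => hXnn r) hXd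
            (fun r hr => ?_) ⟨hts.le, le_rfl⟩
          have h1 := hK hν hts h' (fun r hr => hmean r (hsub hr)) r hr (Xd r) (hXd r hr)
          rw [hγ, hC]
          calc Xd r ≤ K * ν ^ (-((q + 3) / (q - 3))) * X r ^ ((q - 1) / (q - 3)) := h1
            _ ≤ K₁ * ν ^ (-e) * X r ^ ((q - 1) / (q - 3)) := by
                have hXγ : 0 ≤ X r ^ ((q - 1) / (q - 3)) := Real.rpow_nonneg (hXnn r) _
                have hνe0 : 0 ≤ ν ^ (-e) := Real.rpow_nonneg hν.le _
                have hKK : K ≤ K₁ := by rw [hK₁]; linarith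
                rw [he] at hνe0 ⊢
                exact mul_le_mul_of_nonneg_right (mul_le_mul_of_nonneg_right hKK hνe0) hXγ
      have hms : m ≤ (X t + δ) ^ (1 - γ) - (γ - 1) * C * (s - t) := by
        rw [hm]
        have : (γ - 1) * C * (s - t) ≤ (γ - 1) * C * (T - t) :=
          mul_le_mul_of_nonneg_left (by linarith [hs.2]) (mul_nonneg (by linarith) hCpos.le)
        linarith
      have hXsδ : 0 < X s + δ := by linarith [hXnn s]
      have := add_le_rpow_of_le_rpow_one_sub hγgt hXsδ hm0 (hms.trans hcomp)
      linarith
    -- bound on `[a, t]` by continuity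
    have hleft : BddAbove (X '' Icc a t) := by
      rcases lt_or_ge a t with hat | hta
      · have hsub : Icc a t ⊆ Ico a T := fun r hr => ⟨hr.1, hr.2.trans_lt ht.2⟩
        have h' : Torus.IsClassicalNSSolutionOn (Icc a t) ν 0 u p :=
          h.mono hsub (uniqueDiffOn_Icc hat)
        have hcont : ContinuousOn X (Icc a t) := fun r hr => by
          obtain ⟨R, hR⟩ := hasDerivWithinAt_integral_norm_rpow h'.smooth_velocity hat hq2 hr
          exact hR.continuousWithinAt
        exact isCompact_Icc.bddAbove_image hcont
      · refine ⟨X t, ?_⟩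
        rintro _ ⟨r, hr, rfl⟩
        have : r = t := le_antisymm hr.2 (hta.trans hr.1)
        rw [this]
    obtain ⟨M', hM'⟩ := hleft
    apply hunb
    refine ⟨max M M', ?_⟩
    rintro _ ⟨s, hs, rfl⟩
    rcases le_or_gt t s with hts | hst
    · exact (hright s ⟨hts, hs.2⟩).trans (le_max_left _ _)
    · exact (hM' ⟨s, ⟨hs.1, hst.le⟩, rfl⟩).trans (le_max_right _ _)
  -- ### from the key claim to the rate
  have hXt0 : 0 < X t := by
    rcases (hXnn t).eq_or_lt with h0 | h0
    · exfalso
      rw [← h0, Real.zero_rpow (by rw [hγ1]; positivity), mul_zero] at hkey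
      linarith
    · exact h0
  have hLpos : 0 < (γ - 1) * C * (T - t) := mul_pos (mul_pos (by linarith) hCpos) htT
  -- `c ν^e / (T − t) ≤ X(t)^{γ−1}`
  have h1 : 1 / ((γ - 1) * K₁) * ν ^ e / (T - t) ≤ X t ^ (γ - 1) := by
    have e1 : 1 / ((γ - 1) * K₁) * ν ^ e / (T - t) = ((γ - 1) * C * (T - t))⁻¹ := by
      rw [hC, Real.rpow_neg hν.le]
      field_simp
    rw [e1, inv_le_iff_one_le_mul₀ hLpos]
    linarith [hkey]
  have hexp : 0 ≤ (q - 3) / (2 * q) := by positivity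
  have h2 := Real.rpow_le_rpow (by positivity) h1 hexp
  have e2 : (X t ^ (γ - 1)) ^ ((q - 3) / (2 * q)) = X t ^ (1 / q) := by
    rw [← Real.rpow_mul (hXnn t), hγ1]
    congr 1
    field_simp
  rw [e2] at h2
  exact h2

end Literature.Analysis.FluidPDE
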